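/-
Copyright (c) 2026 the pub-hodgecm-mathlib formalisation cell (harness21).  Prover seat hodgecm-mathlib-K2Liu-p13 (g0), Track B «K2-LIT»,
#184♮ = hLiu418 = `stmt-HodgeConjecture-24832`; #42S payer road, organ S3 (census-first 2026-09-04T09:13:59Z on `K2/STATUS.md`; LEAD F0P6-plan (g13) RULING
«M-157l» (1)), file S3-F1.
-/
import Summits.HodgeConjecture.HodgeConjecture.Theorems.K2LiuIsStdPlaceAdapted   -- ★ BRICK 2: `exists_finset_mul_cover`, `siegelDeltaLoc` currency
import HarnessLib

/-!
# Crux `HLiu418`, #42S payer road, organ S3, file S3-F1: LEVEL-`U` SIEGEL SECTIONS AT A FINITE PLACE FORM A FINITE-DIMENSIONAL SPACE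
# (a section is determined by its values on an Iwasawa compact `K₀`; an open `U` has finitely many cosets in `K₀`)

Cell `hodgecm-mathlib`, crux item hLiu418 = `stmt-HodgeConjecture-24832`; squad K2 ∕ K2Liu; LEAD F0P6-plan (g13), co-dealer K2E5-plan (g6); prover K2Liu-p13 (g0).
THEOREMS ONLY (no `def`, no instance, no notation, no named-fact hypothesis, no `sorry`); lane `--supports stmt-HodgeConjecture-24832 --as helper` (count-neutral).

WHY (organ S3 of the #42S payer road, census `K2/K2Liu-p13/g0/CENSUS-42S-PayerRoad.K2Liu-p13-g0.md` §3).  To write a `K`-finite standard section at `s = ½` as a FINITE SUM of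
sections PURE at the finitely many non-spherical places (file S3-F3), one needs at each such place `v` that the slices live in a FINITE-DIMENSIONAL space: the local Siegel
sections of `I_v(s, χ_v)` right-invariant under a given open subgroup `U ≤ H_v`.  This file proves exactly that, abstractly and then in the tree's local currency:
* §1 (ANY topological group `G`) **`finiteDimensional_of_determined_on_compact`**: if every `f` in a subspace `S ≤ (G → ℂ)` satisfies a left law
  `f (p g) = χ p · f g` for `p` in a subgroup `P`, is right-invariant under an OPEN subgroup `U`, and `G = P · K₀` for a COMPACT subgroup `K₀` (Iwasawa binder BY
  VALUE), then `S` is finite-dimensional — evaluation at a finite set `T ⊆ K₀` of `U`-coset representatives (★ BRICK 2 `exists_finset_mul_cover`) is an injective linear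
  map `S →ₗ[ℂ] (T → ℂ)` (`eval_injective_of_determined_on_compact`).  [BorelJacquet1979, §4.1 (admissibility of induced representations)], [Casselman1980, §3],
  [HarrisKudlaSweet1996, §1 (1.15)].
* §2 (the doubled group `H_v = U(𝕍 ⊕ −𝕍)(L⁺_v)` of the K2Liu datum) **`finiteDimensional_localSections_of_iwasawa`**: for a compact `K₀ ≤ H_v` with
  `∀ g, ∃ p ∈ siegelDeltaLoc v, ∃ k ∈ K₀, g = p k` (the binder ★ BRICK 2 `exists_isStd_placeAdapted` DISCHARGES for `K₀ = pr_v C_f` of a standard datum) and an open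
  `U ≤ H_v`, every subspace of functions that are local Siegel sections for SOME left character on `siegelDeltaLoc v` (e.g. ★ `siegelCharLoc χ v s`, or ★
  `localSiegelCharacter` through ★ `mem_siegelDeltaLoc_iff_local`) and right-`U`-invariant is finite-dimensional — the level-`U` part of `I_v(s, χ_v)` is
  ADMISSIBLE.  Consumers: S3-F2∕F3 (pure-tensor decomposition at the bad places), S1 (counting arguments), U1-fin.
HONEST LABEL.  Count-neutral helper: `HC_CM` is proved only modulo the 7 printed citations (2 remaining named inputs: hLiu418 = `stmt-HodgeConjecture-24832`,
h413 = `stmt-HodgeConjecture-24833`) until rung 0 closes.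
-/

set_option autoImplicit false
set_option linter.dupNamespace false -- the mandated namespace repeats `HodgeConjecture.HodgeConjecture`

noncomputable section

open NumberField IsDedekindDomain
open scoped Matrix

namespace Summit.HodgeConjecture.HodgeConjecture.Cruxes.HLiu418.K2LiuLocalDegPSLevelFinite

open Literature.NumberTheory.Automorphic hiding IsKFinite
open Literature.NumberTheory.GaloisRepresentations
open Literature.NumberTheory.GelbartRogawski1991 Literature.NumberTheory.GelbartRogawski1991.GRConstruction
open Literature.NumberTheory.K2Lit.SiegelDoubled
open Summit.HodgeConjecture.HodgeConjecture.Cruxes.HLiu418.K2LiuIsStdPlaceAdapted (exists_finset_mul_cover)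

/-! ## §1 Abstract: sections determined on a compact set modulo an open subgroup -/

section Abstract

variable {G : Type*} [Group G] [TopologicalSpace G] [IsTopologicalGroup G]

omit [TopologicalSpace G] [IsTopologicalGroup G] in
/-- **a section vanishing on a set of `U`-coset representatives of `K₀` vanishes**: if `f (p g) = χ p · f g` (`p ∈ P`), `f (g u) = f g` (`u ∈ U`), `G = P·K₀` and
`K₀ ⊆ T · U`, then `f = 0` as soon as `f t = 0` for all `t ∈ T`. [cite: BorelJacquet1979, §4.1] [cite: Casselman1980, §3] -/
theorem eq_zero_of_apply_eq_zero_on {P K₀ U : Subgroup G} {χ : G → ℂ} (hIw : ∀ g : G, ∃ p ∈ P, ∃ k ∈ K₀, g = p * k)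
    {T : Finset G} (hT : ∀ g ∈ K₀, ∃ t ∈ T, ∃ u ∈ U, g = t * u) {f : G → ℂ}
    (hP : ∀ p ∈ P, ∀ g, f (p * g) = χ p * f g) (hU : ∀ g, ∀ u ∈ U, f (g * u) = f g) (h0 : ∀ t ∈ T, f t = 0) : f = 0 := by
  funext g
  obtain ⟨p, hp, k, hk, rfl⟩ := hIw g
  obtain ⟨t, ht, u, hu, rfl⟩ := hT k hk
  rw [hP p hp, ← mul_assoc, hU _ u hu, h0 t ht, mul_zero, Pi.zero_apply]

omit [TopologicalSpace G] [IsTopologicalGroup G] in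
/-- **evaluation at the representatives is injective** on any subspace of such sections. [cite: BorelJacquet1979, §4.1] [cite: Casselman1980, §3] -/
theorem eval_injective_of_determined_on_compact {P K₀ U : Subgroup G} {χ : G → ℂ} (hIw : ∀ g : G, ∃ p ∈ P, ∃ k ∈ K₀, g = p * k)
    {T : Finset G} (hT : ∀ g ∈ K₀, ∃ t ∈ T, ∃ u ∈ U, g = t * u) (S : Submodule ℂ (G → ℂ))
    (hS : ∀ f ∈ S, (∀ p ∈ P, ∀ g, f (p * g) = χ p * f g) ∧ ∀ g, ∀ u ∈ U, f (g * u) = f g) :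
    Function.Injective (fun f : S => fun t : {t : G // t ∈ T} => (f : G → ℂ) t) := by
  intro f f' hff'
  apply Subtype.ext
  have hsub : ((f : G → ℂ) - (f' : G → ℂ)) = 0 := by
    have hmem : ((f : G → ℂ) - (f' : G → ℂ)) ∈ S := S.sub_mem f.2 f'.2
    refine eq_zero_of_apply_eq_zero_on hIw hT (hS _ hmem).1 (hS _ hmem).2 fun t ht => ?_
    have h := congrFun hff' ⟨t, ht⟩
    simp only at h
    rw [Pi.sub_apply, h, sub_self]
  exact sub_eq_zero.1 hsub

/-- **SECTIONS DETERMINED ON A COMPACT SET MODULO AN OPEN SUBGROUP FORM A FINITE-DIMENSIONAL SPACE**: `S ≤ (G → ℂ)` with a left `P`-law, right-`U`-invariance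
(`U` OPEN) and `G = P·K₀` (`K₀` COMPACT) is finite-dimensional — `K₀ ⊆ T·U` for a finite `T` (★ `exists_finset_mul_cover`) and evaluation at `T` is injective.
[cite: BorelJacquet1979, §4.1] [cite: Casselman1980, §3] [cite: HarrisKudlaSweet1996, §1 (1.15)] -/
theorem finiteDimensional_of_determined_on_compact {P K₀ U : Subgroup G} {χ : G → ℂ} (hK₀ : IsCompact (K₀ : Set G)) (hUo : IsOpen (U : Set G))
    (hIw : ∀ g : G, ∃ p ∈ P, ∃ k ∈ K₀, g = p * k) (S : Submodule ℂ (G → ℂ))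
    (hS : ∀ f ∈ S, (∀ p ∈ P, ∀ g, f (p * g) = χ p * f g) ∧ ∀ g, ∀ u ∈ U, f (g * u) = f g) :
    FiniteDimensional ℂ S := by
  obtain ⟨T, -, hT⟩ := exists_finset_mul_cover (C := U) (C' := K₀) hUo hK₀
  let ev : S →ₗ[ℂ] ({t : G // t ∈ T} → ℂ) :=
    { toFun := fun f t => (f : G → ℂ) t
      map_add' := fun f f' => rfl
      map_smul' := fun a f => rfl }
  exact Module.Finite.of_injective ev (eval_injective_of_determined_on_compact hIw hT S hS)

omit [TopologicalSpace G] [IsTopologicalGroup G] in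
/-- the DIMENSION BOUND: such a subspace has `finrank ≤ |T|` for every finite `T` with `K₀ ⊆ T·U`. [cite: BorelJacquet1979, §4.1] [cite: Casselman1980, §3] -/
theorem finrank_le_card_of_determined_on_compact {P K₀ U : Subgroup G} {χ : G → ℂ} (hIw : ∀ g : G, ∃ p ∈ P, ∃ k ∈ K₀, g = p * k)
    {T : Finset G} (hT : ∀ g ∈ K₀, ∃ t ∈ T, ∃ u ∈ U, g = t * u) (S : Submodule ℂ (G → ℂ))
    (hS : ∀ f ∈ S, (∀ p ∈ P, ∀ g, f (p * g) = χ p * f g) ∧ ∀ g, ∀ u ∈ U, f (g * u) = f g) :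
    Module.finrank ℂ S ≤ T.card := by
  let ev : S →ₗ[ℂ] ({t : G // t ∈ T} → ℂ) :=
    { toFun := fun f t => (f : G → ℂ) t
      map_add' := fun f f' => rfl
      map_smul' := fun a f => rfl }
  have hinj : Function.Injective ev := eval_injective_of_determined_on_compact hIw hT S hS
  calc Module.finrank ℂ S ≤ Module.finrank ℂ ({t : G // t ∈ T} → ℂ) := LinearMap.finrank_le_finrank_of_injective hinj
    _ = T.card := by rw [Module.finrank_fintype_fun_eq_card, Fintype.card_coe]

end Abstract

/-! ## §2 The doubled group at a finite place: level-`U` Siegel sections are finite-dimensional -/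

variable {L : Type} [Field L] [NumberField L] [IsCMField L]
variable {N M n : ℕ} {e : Fin N × Fin M ≃ Fin n}
  {dV : Fin N → L} {hdV : ∀ i, IsCMField.complexConj L (dV i) = dV i}
  {dW : Fin M → L} {hdW : ∀ i, IsCMField.complexConj L (dW i) = dW i}

/-- **LEVEL-`U` LOCAL SIEGEL SECTIONS ARE FINITE-DIMENSIONAL**: at a finite place `v` of `L⁺`, given a COMPACT `K₀ ≤ H_v` with the local Iwasawa decomposition
`H_v = P_Δ(L⁺_v)·K₀` (binder BY VALUE in the shape of ★ `exists_isStd_placeAdapted`, which discharges it for `K₀ = pr_v C_f` of any standard datum) and an OPEN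
subgroup `U ≤ H_v`, every subspace of functions `H_v → ℂ` that are sections for some left character `χ` on `P_Δ(L⁺_v) = siegelDeltaLoc v` and right-`U`-invariant is
finite-dimensional. [cite: BorelJacquet1979, §4.1] [cite: Casselman1980, §3] [cite: HarrisKudlaSweet1996, §1 (1.15)] -/
theorem finiteDimensional_localSections_of_iwasawa (v : HeightOneSpectrum (𝓞 (Fp L)))
    {K₀ U : Subgroup (UnitaryGroup.localPi L (IsCMField.complexConj L) (n + n) (hermD L e dV hdV dW hdW) v)}
    (hK₀ : IsCompact (K₀ : Set (UnitaryGroup.localPi L (IsCMField.complexConj L) (n + n) (hermD L e dV hdV dW hdW) v)))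
    (hIw : ∀ g : UnitaryGroup.localPi L (IsCMField.complexConj L) (n + n) (hermD L e dV hdV dW hdW) v,
      ∃ p ∈ siegelDeltaLoc L e dV hdV dW hdW v, ∃ k ∈ K₀, g = p * k)
    (hUo : IsOpen (U : Set (UnitaryGroup.localPi L (IsCMField.complexConj L) (n + n) (hermD L e dV hdV dW hdW) v)))
    (χ : UnitaryGroup.localPi L (IsCMField.complexConj L) (n + n) (hermD L e dV hdV dW hdW) v → ℂ)
    (S : Submodule ℂ (UnitaryGroup.localPi L (IsCMField.complexConj L) (n + n) (hermD L e dV hdV dW hdW) v → ℂ))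
    (hS : ∀ f ∈ S, (∀ p ∈ siegelDeltaLoc L e dV hdV dW hdW v, ∀ g, f (p * g) = χ p * f g) ∧ ∀ g, ∀ u ∈ U, f (g * u) = f g) :
    FiniteDimensional ℂ S :=
  finiteDimensional_of_determined_on_compact hK₀ hUo hIw S hS

/-- the same with the dimension bound made explicit through the representatives: `S` injects into `T → ℂ` for every finite `T ⊆ H_v` with `K₀ ⊆ T·U`.
[cite: BorelJacquet1979, §4.1] [cite: Casselman1980, §3] -/
theorem finrank_localSections_le (v : HeightOneSpectrum (𝓞 (Fp L)))
    {K₀ U : Subgroup (UnitaryGroup.localPi L (IsCMField.complexConj L) (n + n) (hermD L e dV hdV dW hdW) v)}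
    (hIw : ∀ g : UnitaryGroup.localPi L (IsCMField.complexConj L) (n + n) (hermD L e dV hdV dW hdW) v,
      ∃ p ∈ siegelDeltaLoc L e dV hdV dW hdW v, ∃ k ∈ K₀, g = p * k)
    {T : Finset (UnitaryGroup.localPi L (IsCMField.complexConj L) (n + n) (hermD L e dV hdV dW hdW) v)}
    (hT : ∀ g ∈ K₀, ∃ t ∈ T, ∃ u ∈ U, g = t * u)
    (χ : UnitaryGroup.localPi L (IsCMField.complexConj L) (n + n) (hermD L e dV hdV dW hdW) v → ℂ)
    (S : Submodule ℂ (UnitaryGroup.localPi L (IsCMField.complexConj L) (n + n) (hermD L e dV hdV dW hdW) v → ℂ))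
    (hS : ∀ f ∈ S, (∀ p ∈ siegelDeltaLoc L e dV hdV dW hdW v, ∀ g, f (p * g) = χ p * f g) ∧ ∀ g, ∀ u ∈ U, f (g * u) = f g) :
    Module.finrank ℂ S ≤ T.card :=
  finrank_le_card_of_determined_on_compact hIw hT S hS

end Summit.HodgeConjecture.HodgeConjecture.Cruxes.HLiu418.K2LiuLocalDegPSLevelFinite

end
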